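/-
Origin: expansion seat `planner-pub-hodgecm-mc-theta-3-g2-0`, handover #1 2026-08-18T21:16Z md5 fe6bb6eb374039f63613432c6a13fc76 (NEW, 470 l.; ns HodgeCM.Model.SupplyInstance; AS-INSTALLED copy = ref3-audited bytes e4be1af74266 (#79 CLEAN) with ONLY the import lines rewritten Literature.* -> HodgeCM.Vendored.H21.*; no stager rewrite needed; imports PKG HodgeCM.PerL34.SupplyAdelic + packet-T3/2 twins RelNormOneTorusLevel, RelNormOneTorusArch, SchwartzBruhatCosetIndica (`HOME/mc/pub-hodgecm-mc-theta-3-g2/aslanded/HodgeCM/Model/SupplyInstance.lean`, md5 fe6bb6eb, 470 lines);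
landed by the packager successor (mc-unitary-1-g3, gen-8 kit) in gate run 32 as `HodgeCM/Model/SupplyInstance.lean` (verbatim).
-/
/-
Copyright (c) 2026. Released under Apache 2.0 license as described in the file LICENSE.
Cell pub-hodgecm, MODEL layer (construction prover mc-theta-3, gen 2), node W7a-inst of `MODEL-DAG.md`.
-/
import Summits.HodgeConjecture.HodgeCM.PerL34.SupplyAdelic
import Literature.NumberTheory.Automorphic.RelNormOneTorusLevel
import Literature.NumberTheory.Automorphic.RelNormOneTorusArch
import Literature.NumberTheory.Automorphic.SchwartzBruhatCosetIndicator
import Literature.NumberTheory.Weil1964.AdelicThetaMajorants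

/-!
# The route-(E) supply bridge over the CONSTRUCTED carriers

`HodgeCM.PerL34.SupplyAdelic.SupplyBridgeA T V c k` (the gen-3 bridge record of route (E); its field labels
SETUP / DICTIONARY / D5 `weight` / PRINT `cont`, `inv` / RESIDUAL `form_of_lift` are explained in that module) is an
ABSTRACT record: its carriers (`DS.A₁ = U(W_j)(𝔸)`, `rat = U(W_j)(L₀)`, `ν`, `B`, `VK`, `Vf`, `L̂`, `E`, `L_E`, `φ_N`, …)
are fields, two of its properties (`instD`: `U(W_j)(L₀)` is discrete in `U(W_j)(𝔸)`; `instQ`: `[U(W_j)]` is compact)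
are PRINT records quoted from Cassels–Fröhlich and Godement, and two more (`cont`, `inv`) are PRINT records from
Weil 1964, Théorème 6.

This module INSTANTIATES the record over the carriers constructed (kernel-checked, no cited facts) in the model
layer of the tree:

* the torus `U(W_j) = U(1)_{L/K}`: `DS.A₁ := relNormOneIdeles K L = ker (N_{L/K} : 𝔸_Lˣ → 𝔸_Lˣ)`,
  `rat := relNormOneRat K L` (the principal ideles in it), `ν := probHaarRelNormOneQuot K L`; the PRINT fields
  `instD`, `instQ` become the THEOREMS `discreteTopology_relNormOneRat`, `compactSpace_relNormOneQuot` of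
  `Literature.NumberTheory.Automorphic.RelNormOneTorus` (kernel: discreteness of `Lˣ ⊂ 𝔸_Lˣ`, compactness of
  `𝔸_L¹/Lˣ` by finite representatives), and `ν` is a right-invariant probability measure of full support
  (`RelNormOneTorusLevel`); the archimedean torus `B := relNormOneInfUnits K L = U(1)_{L/K}(K ⊗ ℝ)` with its
  embedding `i := relNormOneInfToIdeles K L` (`RelNormOneTorusArch`);
* the Schwartz–Bruhat side: `DS.S₁ := piSchwartzBruhat K J = 𝒮(𝔸_K^J)` (restricted tensor products of an
  archimedean Schwartz function and finite-adelic Schwartz–Bruhat functions, `AdelicPiSchwartzBruhatFourier`),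
  `DS.X₁ := J → K` (the rational points), `DS.ev₁ φ ξ := φ(ξ)` (evaluation at the principal adelic point
  `ratPt K J ξ`), so that the record's theta kernel `DS.thetaKernel₁ φ g u = Σ_{ξ ∈ K^J} (ω(g,u)φ)(ξ)` IS the tree's
  theta distribution `thetaDist K J (ω(g,u)φ)` (`Weil1964.AdelicThetaDistribution`) — definitionally
  (`WeilLineData.kernel_eq`);
* the test functions `φ_N := φ_∞ ⊗ 1_{x₀ + N 𝒪̂_K^J}` = `thinCosetTestFun K J φ_∞ x₀ (N)`
  (`SchwartzBruhatCosetIndicator`), members of `𝒮(𝔸_K^J)` (`thinCosetTestFun_mem_piSchwartzBruhat`); the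
  DICTIONARY field `ev_phiN` (`φ_N(ξ) = 1[ξ ∈ x₀ + N L] φ_∞(ξ)`) becomes the THEOREM `testFun_ratPt`, whose content
  is `(N)𝒪̂_K = N • 𝒪̂_K` (`mem_levelIdeal_span_natCast_iff`) and `K ∩ 𝒪̂_K = 𝓞_K`
  (`algebraMap_mem_levelIdeal_top_iff`);
* the lattice side: `VK := K^J`, `Vf := (𝔸_K^∞)^J` (a `ℚ`-module by restriction of scalars along `ℚ → K`),
  `ι_f` the diagonal embedding, `L̂ := 𝒪̂_K^J`, `E := (K ⊗ ℝ)^J` (Mathlib's `mixedSpace K`), `ι` the Minkowski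
  embedding, `L_E := (ι 𝓞_K)^J` (Mathlib's `integerLattice K`, DISCRETE: Mathlib), `hL` (`ι(K^J ∩ 𝒪̂^J) ⊂ L_E`)
  and `hinj` (Minkowski embedding injective) THEOREMS;
* `g₀ := 1` (PerL § 4 evaluates the lift at the identity of `G_U(𝔸)` only — ll. 540–632 concern the fixed lines
  `W_j`, one at a time), `eX := Equiv.refl`, and `act_one`/`act_mul`/`act_smul`/`ev_smul` THEOREMS because the Weil
  action enters as a genuine `Representation ℂ (G_U(𝔸) × U(W_j)(𝔸)) 𝒮(𝔸_K^J)`.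

## What stays an explicit INPUT (hypothesis nodes; nothing is cited, nothing minted)

The structure `WeilLineData K L J GU` carries, besides the data `ω` (the Weil action of the pair at the Schrödinger
model), `φ_∞`, `x₀`, `w`:

* (W-wt) `weight`: `φ_N` is a weight-`w` vector of the archimedean torus (= the record's D5 field, verbatim);
* (W-maj) `majorants`: Weil's `M`-test hypothesis `HasThetaMajorants` for `u ↦ ω(1,u)` (`AdelicThetaMajorants`;
  it is a THEOREM for the tensor-product action of a smooth finite part, `hasThetaMajorants_adelicRep_of_isSmooth` in
  `Weil1964.AdelicThetaTensorRep`, which is how node W2 delivers `ω`) — it GIVES the PRINT field `cont`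
  (`HasThetaMajorants.continuous_thetaDistLM`, Weil's Thm 6 conjunct 1 as a theorem);
* (W-rat) `theta_rat`: the rational torus points act by elements of the stabiliser monoid of the theta
  distribution, `ω(1,γ) ∈ thetaStabilizerEnd K J` for `γ ∈ U(W_j)(L₀)`, i.e. `Θ(ω(1,γ)Φ) = Θ(Φ)` (Weil's Thm 6
  conjunct 2 along the splitting; the tree proves the membership for the three generator types of Weil's
  `Ps(X)_k`: `twistLM_ratGL_mem_thetaStabilizerEnd`, `chirpLM_ratMatrix_mem_thetaStabilizerEnd`,
  `fourierLM_mem_thetaStabilizerEnd` in `AdelicThetaMajorants`) — it GIVES the PRINT field `inv`;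
* (W-res) `Residual`: the record's RESIDUAL field `form_of_lift`, verbatim over the constructed carriers (node W6b:
  `thetaForm_ne_zero_of_thetaLift_ne_zero` + `ThetaKernelDatum.exists_thetaClass_ne_zero` + holomorphy + descent).

Main declarations: `WeilLineData.bridge : SupplyBridgeA T V c k` (the instantiated record),
`WeilLineData.supply` (`∃ Γ, ∃ ω ∈ T.Theta V c k Γ, ω ≠ 0`), `open_supply_of_lineSupplyData : … → T.Open_supply`.

Source dictionary (PerL v5, `paper.tex`): l. 263 "`θ_Φ(g,h) = Σ_{x ∈ (V₃⊗W)(L₀)} (ω(g,h)Φ)(x)` its theta kernel.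
For a line `W`, a splitting character `μ` and an automorphic character `χ'` of `[U(W)]` put
`θ(φ,χ') := ∫_{[U(W)]} θ_φ(·,u) χ'(u) du`" — here `DS.thetaKernel₁`, `SupplyBridgeA.lift`; Lemma 4.2 (`lem:chars`,
l. 527) (b) "the theta space `π_i := Θ^{W_i}_{μ_i}(χ'_i)` is non-zero" — here `WeilLineData.supply` modulo (W-res).
The symplectic space is `Res_{L/K}(V₃ ⊗_L W_j)` (`K = L₀`), of dimension `6` over `K`; `J` indexes a `K`-basis of a
Lagrangian (`J = Fin 3` in the application; the construction is uniform in a finite `J`).  The construction is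
uniform in a finite extension `L/K` of number fields; in the application `L` is the CM field, `K` its maximal
real subfield (`↥(NumberField.maximalRealSubfield L)`, as in `RelNormOneTorus` § CM) and
`w = archWeight L m` (`UnitaryLineCharacters`) for the infinity type `m = e(Ψ_j)` of PerL Lemma 4.1(a).
-/

set_option autoImplicit false

noncomputable section

open MeasureTheory NumberField NumberField.mixedEmbedding IsDedekindDomain IsDedekindDomain.HeightOneSpectrum
open Literature.NumberTheory.Automorphic Literature.NumberTheory.Weil1964
open HodgeCM.PerL34.Seesaw HodgeCM.PerL34.RationalCoset HodgeCM.PerL34.SupplyAdelic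
open scoped SchwartzMap Classical

namespace HodgeCM
namespace Model
namespace SupplyInstance

/-! ### § 1. Finite-adelic arithmetic: `K ∩ 𝒪̂_K = 𝓞_K` and `(N)𝒪̂_K = N • 𝒪̂_K` -/

section Arithmetic

variable {K : Type} [Field K] [NumberField K]

/-- (Ported verbatim from the HodgeCMPerL package; no docstring in the source.) -/
theorem valued_algebraMap_apply (x : K) (v : HeightOneSpectrum (𝓞 K)) :
    Valued.v (algebraMap K (FiniteAdeleRing (𝓞 K) K) x v) = v.valuation K x := by
  rw [FiniteAdeleRing.algebraMap_apply]
  exact valuedAdicCompletion_eq_valuation' v x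

/-- `K ∩ 𝒪̂_K = 𝓞_K` (`levelIdeal K ⊤ = 𝒪̂_K` by `idealRadius_top`; Mathlib
`HeightOneSpectrum.mem_integers_of_valuation_le_one`). -/
theorem algebraMap_mem_levelIdeal_top_iff (x : K) :
    algebraMap K (FiniteAdeleRing (𝓞 K) K) x ∈ levelIdeal K ⊤ ↔ ∃ r : 𝓞 K, (r : K) = x := by
  simp only [mem_levelIdeal_iff, idealRadius_top, valued_algebraMap_apply]
  constructor
  · intro h
    exact HeightOneSpectrum.mem_integers_of_valuation_le_one K x h
  · rintro ⟨r, rfl⟩ v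
    exact HeightOneSpectrum.valuation_le_one v r

/-- `|(N)|_v = |N|_v` (as in the tree's `NeatLevelImaginaryQuadratic`, not imported to keep the cone small). -/
theorem idealRadius_span_natCast {N : ℕ} (hN : N ≠ 0) (v : HeightOneSpectrum (𝓞 K)) :
    idealRadius K v (Ideal.span {(N : 𝓞 K)}) = v.valuation K (N : K) := by
  have hN' : (N : 𝓞 K) ≠ 0 := Nat.cast_ne_zero.2 hN
  have h0 : Ideal.span {(N : 𝓞 K)} ≠ 0 := by
    rwa [Ne, Ideal.zero_eq_bot, Ideal.span_singleton_eq_bot]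
  rw [idealRadius, FractionalIdeal.count_coe K v h0,
    show ((N : K)) = algebraMap (𝓞 K) K (N : 𝓞 K) by simp, v.valuation_of_algebraMap, v.intValuation_if_neg hN']

/-- `(N)𝒪̂_K = N • 𝒪̂_K` for `N ≥ 1`. -/
theorem mem_levelIdeal_span_natCast_iff {N : ℕ} (hN : N ≠ 0) (y : FiniteAdeleRing (𝓞 K) K) :
    y ∈ levelIdeal K (Ideal.span {(N : 𝓞 K)}) ↔ ∃ l ∈ levelIdeal K ⊤, y = N • l := by
  have hNK : (N : K) ≠ 0 := by exact_mod_cast hN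
  have hNA : (N : FiniteAdeleRing (𝓞 K) K) = algebraMap K (FiniteAdeleRing (𝓞 K) K) (N : K) := by simp
  have hv : ∀ v : HeightOneSpectrum (𝓞 K),
      Valued.v ((N : FiniteAdeleRing (𝓞 K) K) v) = v.valuation K (N : K) := fun v => by
    rw [hNA, valued_algebraMap_apply]
  have hv0 : ∀ v : HeightOneSpectrum (𝓞 K), v.valuation K (N : K) ≠ 0 := fun v =>
    (Valuation.ne_zero_iff _).2 hNK
  simp only [mem_levelIdeal_iff, idealRadius_top, idealRadius_span_natCast hN]
  constructor
  · intro h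
    refine ⟨algebraMap K (FiniteAdeleRing (𝓞 K) K) (N : K)⁻¹ * y, fun v => ?_, ?_⟩
    · rw [show (algebraMap K (FiniteAdeleRing (𝓞 K) K) (N : K)⁻¹ * y) v =
          algebraMap K (FiniteAdeleRing (𝓞 K) K) (N : K)⁻¹ v * y v from rfl,
        Valuation.map_mul, valued_algebraMap_apply, map_inv₀]
      calc (v.valuation K (N : K))⁻¹ * Valued.v (y v)
          ≤ (v.valuation K (N : K))⁻¹ * v.valuation K (N : K) := by gcongr; exact h v
        _ = 1 := inv_mul_cancel₀ (hv0 v)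
    · rw [nsmul_eq_mul, ← mul_assoc, hNA, ← map_mul, mul_inv_cancel₀ hNK, map_one, one_mul]
  · rintro ⟨l, hl, rfl⟩ v
    rw [nsmul_eq_mul, show ((N : FiniteAdeleRing (𝓞 K) K) * l) v = (N : FiniteAdeleRing (𝓞 K) K) v * l v
      from rfl, Valuation.map_mul, hv v]
    calc v.valuation K (N : K) * Valued.v (l v) ≤ v.valuation K (N : K) * 1 := by gcongr; exact hl v
      _ = v.valuation K (N : K) := mul_one _

end Arithmetic

/-! ### § 2. The lattice data: `V(K) = K^J`, `V(𝔸_f) = (𝔸_K^∞)^J`, `L̂ = 𝒪̂_K^J`, `V_∞ = (K ⊗ ℝ)^J`, `L_E` -/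

section Lattice

variable (K : Type) [Field K] [NumberField K] (J : Type)

/-- `(𝔸_K^∞)^J` as a `ℚ`-vector space, by restriction of scalars along `ℚ → K` (the record's field `instVfQ`;
a local instance in this file). -/
@[reducible] def ratModule : Module ℚ (J → FiniteAdeleRing (𝓞 K) K) := Module.compHom _ (algebraMap ℚ K)

attribute [local instance] ratModule

/-- (Ported verbatim from the HodgeCMPerL package; no docstring in the source.) -/
theorem rat_smul_def (q : ℚ) (y : J → FiniteAdeleRing (𝓞 K) K) : q • y = (algebraMap ℚ K q) • y := rfl

/-- The diagonal embedding `ι_f : V(K) = K^J → V(𝔸_f) = (𝔸_K^∞)^J`. -/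
def finEmb : (J → K) →ₗ[ℚ] (J → FiniteAdeleRing (𝓞 K) K) where
  toFun ξ := fun j => algebraMap K (FiniteAdeleRing (𝓞 K) K) (ξ j)
  map_add' ξ η := by funext j; simp
  map_smul' q ξ := by
    funext j
    rw [RingHom.id_apply, rat_smul_def, Pi.smul_apply, Pi.smul_apply, Rat.smul_def, map_mul, Algebra.smul_def]
    rfl

/-- (Ported verbatim from the HodgeCMPerL package; no docstring in the source.) -/
@[simp] theorem finEmb_apply (ξ : J → K) (j : J) : finEmb K J ξ j = algebraMap K (FiniteAdeleRing (𝓞 K) K) (ξ j) :=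
  rfl

/-- The adelic lattice `L̂ := 𝒪̂_K^J ⊂ (𝔸_K^∞)^J` (`piLevelIdeal K J ⊤`, as a `ℤ`-submodule). -/
def intLattice : Submodule ℤ (J → FiniteAdeleRing (𝓞 K) K) := (piLevelIdeal K J ⊤).toIntSubmodule

/-- (Ported verbatim from the HodgeCMPerL package; no docstring in the source.) -/
theorem mem_intLattice_iff (y : J → FiniteAdeleRing (𝓞 K) K) : y ∈ intLattice K J ↔ ∀ j, y j ∈ levelIdeal K ⊤ :=
  mem_piLevelIdeal_iff K

/-- `V(K) ∩ L̂ = 𝓞_K^J`: the global lattice of the pair `(ι_f, L̂)` consists of the integral vectors. -/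
theorem mem_globalLattice_iff (ξ : J → K) :
    ξ ∈ globalLattice (finEmb K J) (intLattice K J) ↔ ∀ j, ∃ r : 𝓞 K, (r : K) = ξ j := by
  rw [mem_globalLattice, mem_intLattice_iff]
  exact forall_congr' fun j => algebraMap_mem_levelIdeal_top_iff (ξ j)

/-- The Minkowski embedding `ι : V(K) = K^J → V_∞ = (K ⊗ ℝ)^J`, coordinatewise Mathlib's `mixedEmbedding K`. -/
def archEmb : (J → K) →+ (J → mixedSpace K) where
  toFun ξ := fun j => mixedEmbedding K (ξ j)
  map_zero' := by funext j; simp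
  map_add' ξ η := by funext j; simp

omit [NumberField K] in
/-- (Ported verbatim from the HodgeCMPerL package; no docstring in the source.) -/
@[simp] theorem archEmb_apply (ξ : J → K) : archEmb K J ξ = fun j => mixedEmbedding K (ξ j) := rfl

/-- (Ported verbatim from the HodgeCMPerL package; no docstring in the source.) -/
theorem archEmb_injective : Function.Injective (archEmb K J) := fun ξ η h => by
  funext j
  exact mixedEmbedding_injective K (congrFun h j)

/-- The archimedean lattice `L_E := (ι 𝓞_K)^J ⊂ (K ⊗ ℝ)^J` (coordinatewise Mathlib's `integerLattice K`). -/
def archLattice : Submodule ℤ (J → mixedSpace K) :=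
  Submodule.pi Set.univ fun _ => mixedEmbedding.integerLattice K

omit [NumberField K] in
/-- (Ported verbatim from the HodgeCMPerL package; no docstring in the source.) -/
theorem mem_archLattice_iff (x : J → mixedSpace K) :
    x ∈ archLattice K J ↔ ∀ j, x j ∈ mixedEmbedding.integerLattice K := by
  simp [archLattice, Submodule.mem_pi]

/-- `L_E` is discrete (finite product of copies of the discrete `integerLattice K`). -/
instance discreteTopology_archLattice [Finite J] : DiscreteTopology (archLattice K J) := by
  let e : archLattice K J → (J → mixedEmbedding.integerLattice K) :=
    fun x j => ⟨(x : J → mixedSpace K) j, (mem_archLattice_iff K J _).1 x.2 j⟩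
  have hc : Continuous e :=
    continuous_pi fun j => ((continuous_apply j).comp continuous_subtype_val).subtype_mk _
  have hi : Function.Injective e := fun x y h => Subtype.ext (funext fun j => by
    simpa [e] using congrArg (fun f => ((f j : mixedEmbedding.integerLattice K) : mixedSpace K)) h)
  exact DiscreteTopology.of_continuous_injective hc hi

/-- `ι (V(K) ∩ L̂) ⊂ L_E`. -/
theorem archEmb_mem_archLattice (ξ : J → K) (hξ : ξ ∈ globalLattice (finEmb K J) (intLattice K J)) :
    archEmb K J ξ ∈ archLattice K J := by
  rw [mem_archLattice_iff]
  intro j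
  obtain ⟨r, hr⟩ := (mem_globalLattice_iff K J ξ).1 hξ j
  exact ⟨r, by simp [hr]⟩

/-- The thin coset of the record is the tree's: `ξ ∈ V(K) ∩ (x₀ + N • L̂)` iff `-ι_f x₀ + ι_f ξ ∈ ((N)𝒪̂_K)^J`. -/
theorem mem_thinCosetK_iff_mem_piLevelIdeal {N : ℕ} (hN : N ≠ 0) (x₀ ξ : J → K) :
    ξ ∈ thinCosetK (finEmb K J) (intLattice K J) x₀ N ↔
      -finEmb K J x₀ + finEmb K J ξ ∈ piLevelIdeal K J (Ideal.span {(N : 𝓞 K)}) := by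
  rw [mem_thinCosetK, mem_piLevelIdeal_iff]
  constructor
  · rintro ⟨l, hl, h⟩ j
    rw [Pi.add_apply, Pi.neg_apply, h, Pi.add_apply, Pi.smul_apply, neg_add_cancel_left]
    exact (mem_levelIdeal_span_natCast_iff hN _).2 ⟨l j, (mem_intLattice_iff K J l).1 hl j, rfl⟩
  · intro h
    choose l hl hy using fun j => (mem_levelIdeal_span_natCast_iff hN _).1 (h j)
    refine ⟨l, (mem_intLattice_iff K J l).2 hl, funext fun j => ?_⟩
    rw [Pi.add_apply, Pi.smul_apply, ← hy j, Pi.add_apply, Pi.neg_apply, add_neg_cancel_left]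

end Lattice

/-! ### § 3. The test functions `φ_N = φ_∞ ⊗ 1_{x₀ + N L̂}` -/

section TestFun

variable (K : Type) [Field K] [NumberField K] (J : Type) [Fintype J]

attribute [local instance] ratModule

/-- `φ_N := φ_∞ ⊗ 1_{ι_f x₀ + (N)𝒪̂_K^J} ∈ 𝒮(𝔸_K^J)` (`thinCosetTestFun`, `thinCosetTestFun_mem_piSchwartzBruhat`). -/
def testFun (Φinf : 𝓢((J → mixedSpace K), ℂ)) (x₀ : J → K) (N : ℕ) : piSchwartzBruhat K J :=
  ⟨thinCosetTestFun K J Φinf (finEmb K J x₀) (Ideal.span {(N : 𝓞 K)}),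
    thinCosetTestFun_mem_piSchwartzBruhat Φinf _ _⟩

/-- (Ported verbatim from the HodgeCMPerL package; no docstring in the source.) -/
@[simp] theorem coe_testFun (Φinf : 𝓢((J → mixedSpace K), ℂ)) (x₀ : J → K) (N : ℕ) :
    (testFun K J Φinf x₀ N : (J → AdeleRing (𝓞 K) K) → ℂ) =
      thinCosetTestFun K J Φinf (finEmb K J x₀) (Ideal.span {(N : 𝓞 K)}) := rfl

/-- DICTIONARY field `ev_phiN` as a theorem: `φ_N(ξ) = 1[ξ ∈ x₀ + N L] · φ_∞(ι ξ)` at rational points. -/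
theorem testFun_ratPt (Φinf : 𝓢((J → mixedSpace K), ℂ)) (x₀ : J → K) {N : ℕ} (hN : N ≠ 0) (ξ : J → K) :
    (testFun K J Φinf x₀ N : (J → AdeleRing (𝓞 K) K) → ℂ) (ratPt K J ξ) =
      (thinCosetK (finEmb K J) (intLattice K J) x₀ N).indicator (fun ξ => Φinf (archEmb K J ξ)) ξ := by
  classical
  have hfin : piFinite K J (ratPt K J ξ) = finEmb K J ξ := rfl
  have harch : piArch K J (ratPt K J ξ) = archEmb K J ξ := piArch_algebraMap ξ
  rw [coe_testFun, thinCosetTestFun_apply, hfin, harch, Set.indicator_apply,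
    mem_thinCosetK_iff_mem_piLevelIdeal K J hN]

end TestFun

/-! ### § 4. The input record and the instantiated bridge -/

section Bridge

variable (K L : Type) [Field K] [NumberField K] [Field L] [NumberField L] [Algebra K L] [FiniteDimensional K L]
variable (J : Type) [Fintype J] (GU : Type) [Group GU]

attribute [local instance] ratModule

/-- **Input of the supply for one line `W_j`** over the constructed carriers: the Weil action `ω` of
`G_U(𝔸) × U(W_j)(𝔸)` on `𝒮(𝔸_K^J)` (node W2: Schrödinger model of a Lagrangian of `Res_{L/K}(V₃ ⊗ W_j)`), the
archimedean Schwartz function `φ_∞` (node W3: the lowest-`K_∞`-type vector at the chosen place, a Gaussian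
elsewhere), a rational base point `x₀` with `φ_∞(ι x₀) ≠ 0`, the archimedean weight `w`, and the three PROPERTY
inputs (W-wt), (W-maj), (W-rat) of the module docstring. No field of this structure is a cited fact. -/
structure WeilLineData where
  /-- the Weil action of the pair on `𝒮(𝔸_K^J)` (a genuine representation: HKS splitting) -/
  ω : Representation ℂ (GU × relNormOneIdeles K L) (piSchwartzBruhat K J)
  /-- the archimedean test function `φ_∞ ∈ 𝓢((K ⊗ ℝ)^J)` -/
  Φinf : 𝓢((J → mixedSpace K), ℂ)
  /-- a rational point at which `φ_∞` does not vanish -/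
  x₀ : J → K
  hx₀ : Φinf (archEmb K J x₀) ≠ 0
  /-- the weight of `φ_∞` under the archimedean torus `U(W_j)(K ⊗ ℝ)` -/
  w : relNormOneInfUnits K L → ℂ
  /-- (W-wt) = D5: `ω(1, t_∞) φ_N = w(t_∞) φ_N` for every `N` -/
  weight : ∀ (N : ℕ) (t : relNormOneInfUnits K L),
    ω (1, relNormOneInfToIdeles K L t) (testFun K J Φinf x₀ N) = w t • testFun K J Φinf x₀ N
  /-- (W-maj): local summable majorants for `u ↦ (ω(1,u)Φ)(ξ)`, `ξ ∈ K^J` (Weil's `M`-test hypothesis) -/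
  majorants : HasThetaMajorants fun (u : relNormOneIdeles K L) (Φ : piSchwartzBruhat K J) => ω (1, u) Φ
  /-- (W-rat): `ω(1,γ)` stabilises `Θ` for rational `γ ∈ U(W_j)(L₀)`, i.e. `Θ(ω(1,γ)Φ) = Θ(Φ)`
  (`mem_thetaStabilizerEnd_iff`) -/
  theta_rat : ∀ γ : relNormOneIdeles K L, γ ∈ relNormOneRat K L → ω (1, γ) ∈ thetaStabilizerEnd K J

namespace WeilLineData

variable {K L J GU} (D : WeilLineData K L J GU)

/-- The theta shell of the record: line-`j` fields as constructed; the `W₂`- and `W`-fields, which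
`SupplyBridgeA` never reads (`supply_of_bridgeA` uses `A₁, X₁, S₁, ev₁, ω₁` only), are filled with copies of the
line-`j` data.  (An `abbrev`, so that the record's instance fields are found by unification.) -/
abbrev seesawData : ThetaSeesawData where
  G := GU
  A₁ := relNormOneIdeles K L
  A₂ := relNormOneIdeles K L
  X₁ := J → K
  X₂ := J → K
  S₁ := piSchwartzBruhat K J
  S₂ := piSchwartzBruhat K J
  S := piSchwartzBruhat K J × piSchwartzBruhat K J
  ev₁ φ ξ := (φ : (J → AdeleRing (𝓞 K) K) → ℂ) (ratPt K J ξ)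
  ev₂ φ ξ := (φ : (J → AdeleRing (𝓞 K) K) → ℂ) (ratPt K J ξ)
  ev Φ z := (Φ.1 : (J → AdeleRing (𝓞 K) K) → ℂ) (ratPt K J z.1) * (Φ.2 : (J → AdeleRing (𝓞 K) K) → ℂ) (ratPt K J z.2)
  tmul φ₁ φ₂ := (φ₁, φ₂)
  ω₁ g u φ := D.ω (g, u) φ
  ω₂ g u φ := D.ω (g, u) φ
  ωW g t Φ := (D.ω (g, t.1) Φ.1, D.ω (g, t.2) Φ.2)

/-- The record's theta kernel `u ↦ θ_{φ_N}(1,u)` on `U(W_j)(𝔸)`. -/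
def kernel (N : ℕ) (u : relNormOneIdeles K L) : ℂ :=
  D.seesawData.thetaKernel₁ (testFun K J D.Φinf D.x₀ N) (1 : GU) u

/-- … IS the tree's theta distribution of `ω(1,u)φ_N` (definitionally). -/
theorem kernel_eq (N : ℕ) (u : relNormOneIdeles K L) :
    D.kernel N u = thetaDistLM K J (D.ω (1, u) (testFun K J D.Φinf D.x₀ N)) := rfl

/-- PRINT field `cont` as a theorem (Weil's Thm 6 conjunct 1 from (W-maj) by the `M`-test). -/
theorem continuous_kernel (N : ℕ) : Continuous (D.kernel N) :=
  D.majorants.continuous_thetaDistLM (testFun K J D.Φinf D.x₀ N)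

/-- PRINT field `inv` as a theorem (from (W-rat) and the representation property). -/
theorem kernel_rat_mul (N : ℕ) (γ : relNormOneIdeles K L) (hγ : γ ∈ relNormOneRat K L) (u : relNormOneIdeles K L) :
    D.kernel N (γ * u) = D.kernel N u := by
  rw [kernel_eq, kernel_eq, show ((1 : GU), γ * u) = ((1 : GU), γ) * ((1 : GU), u) by rw [Prod.mk_mul_mk, one_mul],
    map_mul, Module.End.mul_apply]
  exact (mem_thetaStabilizerEnd_iff _).1 (D.theta_rat γ hγ) _

/-- The descended kernel `θ̄_N` on `[U(W_j)]` (= `SupplyBridgeA.thetaBar` of the bridge below). -/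
def kernelBar (N : ℕ) : relNormOneIdeles K L ⧸ relNormOneRat K L → ℂ :=
  descend (relNormOneRat K L) (D.kernel N) (D.kernel_rat_mul N)

variable {U : Universe} (T : U.ThetaModel) {Lc : CMField} {ι₁ : Lc →+* ℂ} (V : HermSpace3 Lc ι₁) (c : SeesawCtx Lc)
  (k : Fin 4)

/-- (W-res) = the record's RESIDUAL field `form_of_lift`, verbatim over the constructed carriers: a non-zero
automorphic theta lift `∫_{[U(W_j)]} θ̄_N χ dν` against a unitary character `χ` of `[U(W_j)]` of the archimedean type
forced by `w` yields a non-zero theta one-form of type index `k` at some level. -/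
def Residual : Prop :=
  ∀ (N : ℕ) (χ : PontryaginDual (relNormOneIdeles K L ⧸ relNormOneRat K L)), 0 < N →
    (∀ t : relNormOneInfUnits K L,
      ((χ ((relNormOneInfToIdeles K L t : relNormOneIdeles K L) : relNormOneIdeles K L ⧸ relNormOneRat K L) :
        Circle) : ℂ) * D.w t = 1) →
    (∫ q, D.kernelBar N q * ((χ q : Circle) : ℂ) ∂(probHaarRelNormOneQuot K L)) ≠ 0 →
      ∃ Γ : Level V, ∃ ω ∈ T.Theta V c k Γ, ω ≠ 0

variable {T V c k}


-- port_pkg: scope closed for this part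
end WeilLineData
end Bridge
end SupplyInstance
end Model
end HodgeCM
end
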